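import Summits.AtomisticToContinuum.HydrodynamicLimit.Theses.AntiMazurCoboundaries
import Summits.AtomisticToContinuum.HydrodynamicLimit.Theses.FluxGibbsianityLdDrude
import Summits.AtomisticToContinuum.HydrodynamicLimit.Theorems.JParityClosureOddContactSymmetryGibbsInvariance
import Summits.AtomisticToContinuum.HydrodynamicLimit.Theorems.KineticFluxLdDecay.Negative.TiltBasics
import Literature.MathematicalPhysics.KineticTheory.HardSphereTwoTimePressure
import Literature.MathematicalPhysics.KineticTheory.HardBallErgodicity
import Literature.Analysis.FluidPDE.HardSphereFlowJointMeasurable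

/-!
# Line `self-tilted-edge-covariance` — crux `KineticFluxLdDecay` (stmt-AtomisticToContinuum-10967)

Skeleton (crux-plan, round 1) of the crux idea `Ideas/self-tilted-edge-covariance.md` (ideator 2; triage r1-1/2/3:
pass ×3). The crux is SHARED: `AntiMazurCoboundaries.KineticFluxLdDecay` (r4, payload route) and
`FluxGibbsianityLdDrude.KineticFluxLdDecay` (r2) are the same term; the composition below concludes BOTH by name.

THE LEVER (exact, finite `N`, every flow). Write `J_u(z) = ∫₀ᵘ F(Φ_r z) dr` for the path integral of the crux's
one-body observable `F = Σᵢ φ(xᵢ) g(wᵢ)` and `μ^{β,u} ∝ e^{β J_u} μ` for the law SELF-TILTED over the forward window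
`[0,u]` at rate `β` (`μ = G_N`, flow-invariant). Differentiating `log E_μ e^{β J_s}` ALONG THE WINDOW and using the
invariance of `μ` twice gives (`SelfTiltIdentities`, stub 1, TRUE):
  `log E_μ e^{β J_h} = β h E_μ F + β² ∫₀ʰ ∫₀ˢ 𝒞_β(u) du ds`,  `𝒞_β(u) := Cov_{μ^{β,u}}(F∘Φ_u, F)`
— the covariance of the flux at the two EDGES of the tilted window (forward form of the card's identity, as the
triage r1-3 sharpening asks: no negative times in any statement) — and its quadratic shadow
`E_μ (h⁻¹J_h)² = 2h⁻² ∫₀ʰ∫₀ˢ 𝒞_0(u) du ds + (E_μ F)²`. The crux's functional is the member `β = 1/h`; the L² shadow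
(`FastObservableMeanErgodic`, shared item 10952) is the member `β = 0`.

THE CRITERION (triage r1-2: "register THAT as the stubs, not C⁺"). `∂_β 𝒞_β(u) = κ₃^{μ^{β,u}}(F∘Φ_u, F, J_u)` (joint
third cumulant under the self-tilt), so by the mean value theorem (`TiltedCumulantComparison`, stub 2, TRUE)
`∫₀ʰ∫₀ˢ 𝒞_{1/h} ≤ ∫₀ʰ∫₀ˢ 𝒞_0 + h⁻¹ K h²/2` whenever `|κ₃^{μ^{β,u}}(F∘Φ_u, F, J_u)| ≤ K` on `u ≤ h`, `β ≤ 1/h`.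
Hence `log E e^{avg_h F} ≤ E F − (E F)²/2 + ½ E(avg_h F)² + K/(2h) ≤ ½ + ½E(avg_h F)² + K/(2h)`:
  **10967 ⟸ 10952 ∧ [sup_{u ≤ h, β ≤ 1/h} (N+1)⁻¹ |κ₃^{μ^{β,u}}| = o(h) uniformly in N]**.
The L² input enters at its OWN window `τ₁` and is moved to the multiple `m τ₁ ≥ τ₀` by window monotonicity of the
quadratic functional (`SquareWindowMonotone`, stub 3, TRUE: Jensen over `m` sub-windows + invariance); the OPEN
content is ONE object, the sublinear growth of the self-tilted third cumulant for all large kinetic windows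
(`TiltedThirdCumulantSublinear`, stub 5, hardest) — an `N`-uniform LD-strength statement (triage r1-1: the sup runs
over extensive path tilts of amplitude up to `κ` per particle; it isolates, it does not cheapen), which is where the
crux's amplitude clause `∃κ` and `⊥ v, |v|²` are consumed (Gibbs-tilt near-misses of `Disproof.lean` §3: at large
amplitude the self-tilted law condenses onto a drifted/heated Gibbs state and `K₃ ≍ h·N`).

Composition (sorry-free): `exponent_bound` (real arithmetic) and `kineticFluxLdDecay_of_parts`
(`σ₀ := min`, `κ` from stub 5, L² tolerance `δ/4`, window `τ := m τ₁` with `m = ⌈τ₀/τ₁⌉₊ + 1`,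
`N₀ := max N₁ (max N₅ ⌈2/δ⌉₊)`; for `μ = G_N`: probability from 10952's clause (A), invariance
`Theorems.measurePreserving_flow_localGibbsLaw_const` (PROVED), `G_N(goodᶜ) = 0` from
`localGibbsLaw_absolutelyContinuous`); `KineticFluxLdDecay_of : AntiMazurCoboundaries.KineticFluxLdDecay` and
`KineticFluxLdDecay_of_sibling : FluxGibbsianityLdDrude.KineticFluxLdDecay` BY NAME from the five registered stubs.
-/

noncomputable section

open MeasureTheory ProbabilityTheory Set Filter Topology
open scoped ENNReal

namespace Summit.AtomisticToContinuum.HydrodynamicLimit.Cruxes.KineticFluxLdDecay.SelfTiltedEdgeCovariance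

open Literature.MathematicalPhysics.KineticTheory (T3 V3 hsDiameter localGibbsLaw)
open Literature.Analysis.FluidPDE (HardSphereFlow Config)

/-! ## Frame abbreviations (all reducible; the crux decls are matched by unfolding) -/

/-- Hard-sphere flows of `n` spheres of diameter `ε` on `𝕋³` (abstract frame of stubs 1–3). -/
abbrev TFlow (ε : ℝ) (n : ℕ) : Type :=
  HardSphereFlow (Literature.Analysis.FluidPDE.Torus.geometry (Fin 3)) ε n

/-- Phase space of `n` spheres on `𝕋³`. -/
abbrev TPhase (n : ℕ) : Type := Config n (Fin 3) T3

/-- The crux's flows: `N + 1` spheres of reduced diameter `σ`, i.e. diameter `σ (N+1)^{-1/3}`. -/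
abbrev Flow (σ : ℝ) (N : ℕ) : Type := TFlow (hsDiameter σ N) (N + 1)

/-- The crux's phase space. -/
abbrev Phase (N : ℕ) : Type := TPhase (N + 1)

/-- The flow-invariant global Gibbs law `G_N` of the crux (constant profiles `a, u₀, θ`). -/
abbrev gibbs (σ a θ : ℝ) (u₀ : V3) (N : ℕ) (Φ : Flow σ N) : Measure (Phase N) :=
  localGibbsLaw σ (fun _ => a) (fun _ => u₀) (fun _ => θ) N Φ

/-- The fast one-body observable `F(z) = Σᵢ φ(xᵢ) g((vᵢ − u₀)/√θ)` of the crux. -/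
abbrev fluxObs (θ : ℝ) (u₀ : V3) (φ : T3 → ℝ) (g : V3 → ℝ) (N : ℕ) (z : Phase N) : ℝ :=
  ∑ i, φ (z i).1 * g ((Real.sqrt θ)⁻¹ • ((z i).2 - u₀))

/-- The kinetic window `h = τ (N+1)^{-1/3}` (macroscopic time of `τ × O(1)` mean free times). -/
abbrev window (τ : ℝ) (N : ℕ) : ℝ := τ * ((N + 1 : ℕ) : ℝ) ^ (-(1 / 3 : ℝ))

/-- The crux's orthogonality clause `g ⊥ span{1, v, |v|²}` in `L²(stdGaussian ℝ³)`. -/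
abbrev Orthogonal (g : V3 → ℝ) : Prop :=
  ∀ (c₀ c₂ : ℝ) (b : V3),
    ∫ v, g v * (c₀ + inner ℝ b v + c₂ * ‖v‖ ^ 2) ∂(ProbabilityTheory.stdGaussian V3) = 0

/-! ## The self-tilted objects of the line (forward window `[0, u]`) -/

section Tilt

variable {ε : ℝ} {n : ℕ}

/-- Path integral of the observable along the orbit over the forward window: `J_u(z) = ∫₀ᵘ F(Φ_r z) dr`. -/
abbrev pathInt (Φ : TFlow ε n) (F : TPhase n → ℝ) (u : ℝ) (z : TPhase n) : ℝ :=
  ∫ r in (0 : ℝ)..u, F (Φ.flow r z)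

/-- The self-tilt weight `e^{β J_u(z)}` (density of `μ^{β,u}` w.r.t. `μ`, up to normalisation). -/
def tiltWeight (Φ : TFlow ε n) (F : TPhase n → ℝ) (β u : ℝ) (z : TPhase n) : ℝ :=
  Real.exp (β * pathInt Φ F u z)

/-- Expectation of an observable `X` under the SELF-TILTED law `μ^{β,u} = e^{βJ_u} μ / E_μ e^{βJ_u}`. -/
def tiltMean (Φ : TFlow ε n) (μ : Measure (TPhase n)) (F : TPhase n → ℝ) (β u : ℝ)
    (X : TPhase n → ℝ) : ℝ :=
  (∫ z, X z * tiltWeight Φ F β u z ∂μ) / ∫ z, tiltWeight Φ F β u z ∂μ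

/-- The EDGE COVARIANCE `𝒞_β(u) := Cov_{μ^{β,u}}(F∘Φ_u, F)`: covariance of the flux at the two ends of the
tilted window. At `β = 0` it is the equilibrium autocovariance `Cov_μ(F∘Φ_u, F)`. -/
def edgeCov (Φ : TFlow ε n) (μ : Measure (TPhase n)) (F : TPhase n → ℝ) (β u : ℝ) : ℝ :=
  tiltMean Φ μ F β u (fun z => F (Φ.flow u z) * F z) -
    tiltMean Φ μ F β u (fun z => F (Φ.flow u z)) * tiltMean Φ μ F β u F

/-- The EDGE THIRD CUMULANT `K_β(u) := κ₃^{μ^{β,u}}(F∘Φ_u, F, J_u) = ∂_β 𝒞_β(u)`: the joint third cumulant,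
under the self-tilted law, of the two edge fluxes and the path integral that tilts. -/
def edgeCum (Φ : TFlow ε n) (μ : Measure (TPhase n)) (F : TPhase n → ℝ) (β u : ℝ) : ℝ :=
  tiltMean Φ μ F β u (fun z => F (Φ.flow u z) * F z * pathInt Φ F u z)
    - tiltMean Φ μ F β u (fun z => F (Φ.flow u z) * F z) * tiltMean Φ μ F β u (pathInt Φ F u)
    - tiltMean Φ μ F β u (fun z => F (Φ.flow u z) * pathInt Φ F u z) * tiltMean Φ μ F β u F
    - tiltMean Φ μ F β u (fun z => F z * pathInt Φ F u z) *
        tiltMean Φ μ F β u (fun z => F (Φ.flow u z))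
    + 2 * tiltMean Φ μ F β u (fun z => F (Φ.flow u z)) * tiltMean Φ μ F β u F *
        tiltMean Φ μ F β u (pathInt Φ F u)

/-- The FEJÉR DOUBLE INTEGRAL `I_β(h) := ∫₀ʰ ∫₀ˢ 𝒞_β(u) du ds` (`= ∫₀ʰ (h − u) 𝒞_β(u) du`). -/
def fejerInt (Φ : TFlow ε n) (μ : Measure (TPhase n)) (F : TPhase n → ℝ) (β h : ℝ) : ℝ :=
  ∫ s in (0 : ℝ)..h, ∫ u in (0 : ℝ)..s, edgeCov Φ μ F β u

end Tilt

/-! ## Stub statements -/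

/-- Statement of `stub_selfTiltIdentities` — **the self-tilted edge-covariance identity and its quadratic shadow**
(abstract: any hard-sphere flow `Φ` on `𝕋³`, any `Φ`-invariant probability law `μ` carried by the good set, any
bounded measurable `F`). (i) For every real `β` and window `h > 0`:
`E_μ exp(β J_h) = exp(β h E_μ F + β² I_β(h))`, `I_β(h) = ∫₀ʰ∫₀ˢ 𝒞_β(u) du ds` — written in the crux's `∫⁻ … ofReal`
currency. Proof plan (card + triage r1-2 §E / r1-3 App. C): `Z(s) := E_μ e^{βJ_s}` and `Nu(s) := E_μ[F∘Φ_s e^{βJ_s}]`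
are Lipschitz in `s` (`F` bounded); `Z(h) − 1 = β∫₀ʰ Nu` (Fubini + the pathwise identity
`e^{βJ_h} − 1 = β∫₀ʰ F(Φ_s z) e^{βJ_s(z)} ds` for good `z`, FTC for the Lipschitz function `s ↦ J_s(z)` — approximate
`r ↦ F(Φ_r z)` in `L¹` by continuous functions, or Lebesgue differentiation); shifting by the flow
(`flow_add` on `good`, `μ` invariant) `Nu(s) = E_μ[F · e^{β∫_{−s}^0 F∘Φ_r}]`, whose `s`-derivative (same device) is
`β E_μ[F · F∘Φ_{−s} · e^{β∫_{−s}^0 F∘Φ}]`; shifting back, `d/ds (Nu/Z) = β 𝒞_β(s)` a.e., `Nu(0)/Z(0) = E_μ F`; integrate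
twice (`log Z(h) = ∫₀ʰ Z'/Z`). Measurability of every `u`-integrand: `HardSphereFlow.measurable_flow_prod_torus`,
`aemeasurable_intervalIntegral_comp_flow_torus` (tree, PROVED). (ii) For `h > 0`:
`E_μ (h⁻¹J_h)² = 2h⁻²I_0(h) + (E_μ F)²` (Fubini, stationarity `Cov(F∘Φ_s, F∘Φ_{s−u}) = 𝒞_0(u)`, symmetry of the
square; `E_μ J_h = h E_μ F`). Toy check of (i): kit j009901 (triage r1-3; 4-state CTMC, error ≤ 2.2e-9). -/
def SelfTiltIdentities : Prop :=
  ∀ (ε : ℝ) (n : ℕ) (Φ : TFlow ε n) (μ : Measure (TPhase n)), IsProbabilityMeasure μ →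
    (∀ t, MeasurePreserving (Φ.flow t) μ μ) → μ Φ.goodᶜ = 0 →
    ∀ F : TPhase n → ℝ, Measurable F → (∃ C : ℝ, ∀ z, |F z| ≤ C) →
      (∀ (β h : ℝ), 0 < h →
        ∫⁻ z, ENNReal.ofReal (Real.exp (β * pathInt Φ F h z)) ∂μ =
          ENNReal.ofReal (Real.exp (β * h * (∫ z, F z ∂μ) + β ^ 2 * fejerInt Φ μ F β h))) ∧
      (∀ h : ℝ, 0 < h →
        ∫⁻ z, ENNReal.ofReal ((h⁻¹ * pathInt Φ F h z) ^ 2) ∂μ =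
          ENNReal.ofReal (2 * h⁻¹ ^ 2 * fejerInt Φ μ F 0 h + (∫ z, F z ∂μ) ^ 2))

/-- Statement of `stub_tiltedCumulantComparison` — **the third-cumulant comparison (mean value theorem in the
tilt rate, integrated over the Fejér triangle)**: same abstract data; for `β ≥ 0`, `h > 0` and any `K`, if the edge
third cumulant is bounded, `|κ₃^{μ^{β',u}}(F∘Φ_u, F, J_u)| ≤ K` for all `u ∈ [0,h]`, `β' ∈ [0,β]`, then
`I_β(h) ≤ I_0(h) + β K h²/2`. Proof plan: `β' ↦ tiltMean_{β'}[X]` is differentiable with derivative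
`tiltMean[X J_u] − tiltMean[X] tiltMean[J_u]` (dominated differentiation of `β' ↦ E_μ[X e^{β'J_u}]`; `X`, `J_u` bounded,
`J_u` a.e.-measurable by `aemeasurable_intervalIntegral_comp_flow_torus`), whence `∂_β 𝒞_β(u) = edgeCum … β u`
(joint-cumulant algebra, checked by triage r1-2 §E); MVT ⇒ `|𝒞_β(u) − 𝒞_0(u)| ≤ βK` on `[0,h]`;
`u ↦ 𝒞_β(u)` is bounded and measurable (Fubini after `measurable_flow_prod_torus`), so integrate:
`∫₀ˢ(𝒞_β − 𝒞_0) ≤ sβK`, `∫₀ʰ sβK ds = βKh²/2`. -/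
def TiltedCumulantComparison : Prop :=
  ∀ (ε : ℝ) (n : ℕ) (Φ : TFlow ε n) (μ : Measure (TPhase n)), IsProbabilityMeasure μ →
    (∀ t, MeasurePreserving (Φ.flow t) μ μ) → μ Φ.goodᶜ = 0 →
    ∀ F : TPhase n → ℝ, Measurable F → (∃ C : ℝ, ∀ z, |F z| ≤ C) →
      ∀ (β h K : ℝ), 0 ≤ β → 0 < h →
        (∀ u ∈ Set.Icc (0 : ℝ) h, ∀ β' ∈ Set.Icc (0 : ℝ) β, |edgeCum Φ μ F β' u| ≤ K) →
        fejerInt Φ μ F β h ≤ fejerInt Φ μ F 0 h + β * K * h ^ 2 / 2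

/-- Statement of `stub_squareWindowMonotone` — **window monotonicity of the quadratic (L²-Drude) functional**:
same abstract data; for a window `w > 0` and an integer `m ≥ 1`,
`E_μ ((mw)⁻¹ J_{mw})² ≤ E_μ (w⁻¹ J_w)²` (in `∫⁻ … ofReal` currency). Proof plan: for good `z`,
`J_{mw}(z) = Σ_{k<m} J_w(Φ_{kw} z)` (additivity of the interval integral — `r ↦ F(Φ_r z)` is bounded measurable on
good orbits — and `flow_add` on `good`, nonnegative times only), so `(mw)⁻¹J_{mw} = m⁻¹ Σ_k (w⁻¹J_w)∘Φ_{kw}` and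
`((mw)⁻¹J_{mw})² ≤ m⁻¹ Σ_k ((w⁻¹J_w)∘Φ_{kw})²` (convexity of the square, `Finset.inner_mul_le_norm_mul_norm` /
`sq_sum_le_card_mul_sum_sq`); integrate (`lintegral_mono_ae`, `μ(goodᶜ) = 0`) and use invariance of `μ` under each
`Φ_{kw}` (`lintegral_map'` with the a.e.-measurable integrand). The LD analogue (Hölder instead of Jensen) is the
`WindowMonotonicity` lemma of the sibling idea `meso-window-split` (triage-verified). -/
def SquareWindowMonotone : Prop :=
  ∀ (ε : ℝ) (n : ℕ) (Φ : TFlow ε n) (μ : Measure (TPhase n)), IsProbabilityMeasure μ →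
    (∀ t, MeasurePreserving (Φ.flow t) μ μ) → μ Φ.goodᶜ = 0 →
    ∀ F : TPhase n → ℝ, Measurable F → (∃ C : ℝ, ∀ z, |F z| ≤ C) →
      ∀ (w : ℝ) (m : ℕ), 0 < w → 0 < m →
        ∫⁻ z, ENNReal.ofReal ((((m : ℝ) * w)⁻¹ * pathInt Φ F ((m : ℝ) * w) z) ^ 2) ∂μ ≤
          ∫⁻ z, ENNReal.ofReal ((w⁻¹ * pathInt Φ F w z) ^ 2) ∂μ

/-- Statement of `stub_tiltedThirdCumulantSublinear` — **THE OPEN STUB: the self-tilted edge third cumulant grows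
sublinearly in the kinetic window, uniformly in `N` and in the flow.** In the crux's frame (constant profiles
`a, θ, u₀`; `σ < σ₀`; an amplitude `κ > 0`; continuous `|φ| ≤ 1`, `|g| ≤ κ`, `g ⊥ span{1, v, |v|²}`): for every `δ > 0`
there is a kinetic scale `τ₀` such that for every window `τ ≥ τ₀` and all large `N`, every flow `Φ`, every lag
`u ∈ [0, h]` and tilt rate `β ∈ [0, 1/h]` (`h = τ(N+1)^{-1/3}`):
`|κ₃^{G_N^{β,u}}(F∘Φ_u, F, J_u)| ≤ δ · h · (N+1)`, `F = Σᵢ φ(xᵢ) g((vᵢ−u₀)/√θ)`, `G_N^{β,u} ∝ e^{βJ_u} G_N`.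
In words: the criterion's object `sup_{u ≤ h, β ≤ 1/h} (N+1)⁻¹ K₃ = o(h)` (card: "10967 ⟸ 10952 ∧ sublinear tilted
third cumulant"; verified by triage r1-1/2/3). Heuristic size (card, triage r1-3): `K₃(u) = ∫₀ᵘ κ₃(F∘Φ_u, F, F∘Φ_r) dr`
is `O(N t_c)` uniformly in `u` and `h` when connected three-time correlations of the one-body fluctuation field decay
(at `u ≲ t_c` it is `≍ u N κ³`, at `u ≫ t_c` one of the gaps `u − r`, `r` exceeds `u/2`) — so the statement holds
with room `t_c/(δ h)`; it is an `N`-UNIFORM LD-STRENGTH statement because the sup runs over extensive path tilts of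
amplitude up to `κ` per particle (`|βJ_u| ≤ κ(N+1)`; triage r1-1 "no free lunch"). This stub CONSUMES the crux's
amplitude clause and `⊥ v`, `⊥ |v|²`: for `|g|` large (`Disproof.lean` §3, `kineticFluxLdDecay_false_allAmplitudes`,
`…_without_orthVel/_orthEnergy`) the self-tilted law condenses onto a drifted/heated homogeneous Gibbs law, `𝒞_β(u)`
acquires a `u`-independent part and, by stubs 1–2, `K₃ ≳ 2c N h` (linear, not sublinear) — the first support lemma
of its proof is the SHELL-SECTOR bound (the `(P,E)`-marginal of `G_N^{β,u}` keeps Gaussian concentration at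
`(u₀, θ)` for `κ < κ*`, the positive reading of `tiltFunctional_nonpos_of_admissible`). Dilute-corner shadow
(one quantifier swap, `σ₀` after `δ`): cumulant bounds of BGSSAnnals2023 type beyond Lanford's time +
BodineauEtAl2024 Thm 1.2 — the card's "unbuilt storey", a defined programme. -/
def TiltedThirdCumulantSublinear : Prop :=
  ∀ (a θ : ℝ) (u₀ : V3), 0 < a → 0 < θ → ∃ σ₀ : ℝ, 0 < σ₀ ∧ ∀ σ : ℝ, 0 < σ → σ < σ₀ →
    ∃ κ : ℝ, 0 < κ ∧ ∀ (φ : T3 → ℝ) (g : V3 → ℝ), Continuous φ → Continuous g →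
      (∀ x, |φ x| ≤ 1) → (∀ v, |g v| ≤ κ) → Orthogonal g →
      ∀ δ : ℝ, 0 < δ → ∃ τ₀ : ℝ, 0 < τ₀ ∧ ∀ τ : ℝ, τ₀ ≤ τ → ∃ N₀ : ℕ, ∀ N : ℕ, N₀ ≤ N →
        ∀ Φ : Flow σ N, ∀ u ∈ Set.Icc (0 : ℝ) (window τ N), ∀ β ∈ Set.Icc (0 : ℝ) (window τ N)⁻¹,
          |edgeCum Φ (gibbs σ a θ u₀ N Φ) (fluxObs θ u₀ φ g N) β u| ≤ δ * window τ N * ((N : ℝ) + 1)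

/-! ## Registered stubs -/

/-- STUB 1 (size L; TRUE, provable now — Lipschitz/FTC calculus along the window + two flow shifts; the card's
`EdgeBiasIdentity`/`EdgeCovarianceIdentity` in forward form plus the `β = 0` quadratic shadow). Sources:
DemboZeitouni2010 §2.3/§4.5 (tilted laws, `Λ'' =` tilted variance); Jakšić–Pillet–Rey-Bellet arXiv:1009.3248
(Green–Kubo from LD generating functions of deterministic systems); Spohn1991 Part I §7.2 (7.44);
KipnisLandim1999 App. 1 §7 Lemma 7.2. Tree: `HardSphereFlow.flow_add`, `measurable_flow_prod_torus`,
`aemeasurable_intervalIntegral_comp_flow_torus`, `intervalIntegral.integral_eq_sub_of_hasDerivAt`. -/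
theorem stub_selfTiltIdentities : SelfTiltIdentities := by
  sorry

/-- STUB 2 (size M; TRUE, provable now — dominated differentiation in the tilt rate + MVT + interval-integral
monotonicity). Sources: DemboZeitouni2010 §2.3 (derivatives of tilted expectations are cumulants); triage r1-2 §E
(`∂_β Cov_β(A,B) = κ₃^β(A,B,J)`). Mathlib: `hasDerivAt_integral_of_dominated_loc_of_deriv_le`, `exists_hasDerivAt_eq_slope`,
`intervalIntegral.integral_mono_on`. -/
theorem stub_tiltedCumulantComparison : TiltedCumulantComparison := by
  sorry

/-- STUB 3 (size M; TRUE, provable now — Jensen for the square over `m` sub-windows + invariance; the L² twin of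
`meso-window-split`'s `WindowMonotonicity`). Sources: LepriLiviPoliti2003 §5.2 (order of limits in Green–Kubo);
Mazur1969/Suzuki1971 (tree `Literature.Barriers.AtomisticToContinuum.Mazur.tendsto_timeAverage`). Mathlib:
`intervalIntegral.sum_integral_adjacent_intervals`, `inner_mul_le_norm_mul_norm`/`sq_sum_le_card_mul_sum_sq`,
`MeasureTheory.lintegral_map'`. -/
theorem stub_squareWindowMonotone : SquareWindowMonotone := by
  sorry

/-- STUB 4 (size L; OPEN but strictly weaker in currency than the crux — THE SHARED SUPPORT ITEM
stmt-AtomisticToContinuum-10952 `FluxGibbsianityLdDrude.FastObservableMeanErgodic` BY NAME: uniform-in-`N` L² mean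
ergodicity of fast one-body observables, the `β = 0` member of the identity; closing 10952 closes this stub).
Sources: LepriLiviPoliti2003 §8, Doyon2022 §5.1 Thm 5.1, Spohn1991 Part I Ch. 3; dilute-corner theorem-grade rung:
`AntiMazurCoboundaries.BoltzmannGreenKubo` (13985) after BodineauEtAl2024 Thm 1.2 / BGSSCPAM2023 Thm 1.1. This is
where the line uses `⊥ 1` (`Disproof.kineticFluxLdDecay_false_without_orthogonality`: for `g ≡ κ` the raw second
moment is `κ²(N+1)²`) and `⊥ v, |v|²` at the L² level (Mazur bound by the conserved fields). -/
theorem stub_fastObservableMeanErgodic :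
    Summit.AtomisticToContinuum.HydrodynamicLimit.Theses.FluxGibbsianityLdDrude.FastObservableMeanErgodic := by
  sorry

/-- STUB 5 (size XL; OPEN — the HARDEST, carries the LD-beyond-L² content of the crux: robustness of kinetic
decorrelation under weak extensive self-tilts, as ONE integrated third cumulant). Sources: OllaVaradhanYau1993 §3
(the functional); BGSSAnnals2023 (dynamical cumulant bounds over Lanford's time, arXiv:2008.10403 Thm 4);
BodineauEtAl2024 Thm 1.2 / BGSSCPAM2023 Thm 1.1 (long-time covariance of the fluctuation field, Boltzmann–Grad);
Spohn1991 Part II §2.2; EvansMorriss2008 Ch. 7 (transient-time correlation functions); Disproof.lean §3 (why `∃κ`,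
`⊥ v`, `⊥ |v|²` are load-bearing here). False iff a hidden extensive quasi-local charge overlapping `g` makes
`𝒞_{1/h}(u) ↛ 0` while `𝒞_0(u) → 0` (10967 false with 10952 true; MD falsifier (iv) of the card). -/
theorem stub_tiltedThirdCumulantSublinear : TiltedThirdCumulantSublinear := by
  sorry

/-! ## Composition (sorry-free) -/

/-- **The exponent arithmetic of the criterion.** With `h > 0`, `x = N + 1 ≥ 2/δ`, mean `m = E F`, Fejér integrals
`I₀ = I_0(h)`, `I₁ = I_{1/h}(h)`: the L² input `2h⁻²I₀ + m² ≤ (δ/4)x` and the cumulant comparison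
`I₁ ≤ I₀ + h⁻¹(δ h x)h²/2` give `h⁻¹h·m + h⁻²I₁ ≤ δx` (using `m − m²/2 ≤ ½ ≤ (3δ/8)x`). -/
theorem exponent_bound {h δ x m I₀ I₁ : ℝ} (hh : 0 < h) (hδ : 0 < δ) (hx : 2 / δ ≤ x)
    (hq : 2 * h⁻¹ ^ 2 * I₀ + m ^ 2 ≤ δ / 4 * x)
    (hI : I₁ ≤ I₀ + h⁻¹ * (δ * h * x) * h ^ 2 / 2) :
    h⁻¹ * h * m + h⁻¹ ^ 2 * I₁ ≤ δ * x := by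
  have hne : h ≠ 0 := hh.ne'
  have h1 : h⁻¹ * h = 1 := inv_mul_cancel₀ hne
  have hp : 0 ≤ h⁻¹ ^ 2 := by positivity
  have e : h⁻¹ ^ 2 * (I₀ + h⁻¹ * (δ * h * x) * h ^ 2 / 2) = h⁻¹ ^ 2 * I₀ + δ * x / 2 := by
    field_simp
  have hI' : h⁻¹ ^ 2 * I₁ ≤ h⁻¹ ^ 2 * I₀ + δ * x / 2 := by
    have := mul_le_mul_of_nonneg_left hI hp
    rwa [e] at this
  have hδx : 2 ≤ δ * x := by
    have := (div_le_iff₀ hδ).1 hx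
    linarith [mul_comm x δ]
  have hm : m ≤ (m ^ 2 + 1) / 2 := by nlinarith [sq_nonneg (m - 1)]
  rw [h1, one_mul]
  linarith

/-- Measurability of the crux's one-body observable (continuity; `Config` over the torus is a Borel space). -/
theorem measurable_fluxObs {θ : ℝ} {u₀ : V3} {φ : T3 → ℝ} {g : V3 → ℝ} (hφ : Continuous φ)
    (hg : Continuous g) (N : ℕ) : Measurable (fluxObs θ u₀ φ g N) := by
  refine Continuous.measurable ?_
  unfold fluxObs
  fun_prop

/-- The crux's one-body observable is bounded by `(N+1)κ`. -/
theorem abs_fluxObs_le {θ κ : ℝ} {u₀ : V3} {φ : T3 → ℝ} {g : V3 → ℝ} (hφ1 : ∀ x, |φ x| ≤ 1)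
    (hgκ : ∀ v, |g v| ≤ κ) (N : ℕ) (z : Phase N) : |fluxObs θ u₀ φ g N z| ≤ (N + 1) * κ := by
  have hκ : 0 ≤ κ := (abs_nonneg _).trans (hgκ 0)
  calc |fluxObs θ u₀ φ g N z|
      ≤ ∑ i, |φ (z i).1 * g ((Real.sqrt θ)⁻¹ • ((z i).2 - u₀))| := Finset.abs_sum_le_sum_abs _ _
    _ ≤ ∑ _i : Fin (N + 1), κ := by
        refine Finset.sum_le_sum fun i _ => ?_
        rw [abs_mul]
        calc |φ (z i).1| * |g ((Real.sqrt θ)⁻¹ • ((z i).2 - u₀))|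
            ≤ 1 * κ := mul_le_mul (hφ1 _) (hgκ _) (abs_nonneg _) zero_le_one
          _ = κ := one_mul κ
    _ = (N + 1) * κ := by simp

/-- The global Gibbs law is carried by the good set of the flow (it is absolutely continuous w.r.t. Liouville). -/
theorem gibbs_compl_good (σ a θ : ℝ) (u₀ : V3) (N : ℕ) (Φ : Flow σ N) :
    gibbs σ a θ u₀ N Φ Φ.goodᶜ = 0 :=
  Literature.MathematicalPhysics.KineticTheory.localGibbsLaw_absolutelyContinuous σ (fun _ => a) (fun _ => u₀)
    (fun _ => θ) N Φ Φ.measure_compl_good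

/-- The global Gibbs law is invariant under every hard-sphere flow map (tree theorem, PROVED:
`Theorems.measurePreserving_flow_localGibbsLaw_const` = route support HomogeneousInvariance 9621). -/
theorem gibbs_invariant (σ a θ : ℝ) (u₀ : V3) (N : ℕ) (Φ : Flow σ N) (t : ℝ) :
    MeasurePreserving (Φ.flow t) (gibbs σ a θ u₀ N Φ) (gibbs σ a θ u₀ N Φ) :=
  Summit.AtomisticToContinuum.HydrodynamicLimit.Theorems.measurePreserving_flow_localGibbsLaw_const σ a θ u₀ N Φ t

/-- **Composition of the line** (proved): the five stub statements imply the crux body (spelled with the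
reducible frame abbreviations; `KineticFluxLdDecay_of` below restates it BY NAME). Choices: `σ₀ := min σ₄ σ₅`
(10952's and stub 5's), `κ` from stub 5, L² tolerance `δ/4` at its own window `τ₁`, cumulant tolerance `δ` beyond
`τ₀`, window `τ := m τ₁`, `m = ⌈τ₀/τ₁⌉₊ + 1`, `N₀ := max N₁ (max N₅ ⌈2/δ⌉₊)`; then stub 1 (i) at `β = 1/h`, stub 2
with `K = δ h (N+1)` fed by stub 5, stub 1 (ii) + stub 3 + 10952 for `2h⁻²I₀ + m² ≤ (δ/4)(N+1)`, and
`exponent_bound`. -/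
theorem kineticFluxLdDecay_of_parts (h₁ : SelfTiltIdentities) (h₂ : TiltedCumulantComparison)
    (h₃ : SquareWindowMonotone)
    (h₄ : Summit.AtomisticToContinuum.HydrodynamicLimit.Theses.FluxGibbsianityLdDrude.FastObservableMeanErgodic)
    (h₅ : TiltedThirdCumulantSublinear) :
    ∀ (a θ : ℝ) (u₀ : V3), 0 < a → 0 < θ → ∃ σ₀ : ℝ, 0 < σ₀ ∧ ∀ σ : ℝ, 0 < σ → σ < σ₀ →
      (∀ (N : ℕ) (Φ : Flow σ N), IsProbabilityMeasure (gibbs σ a θ u₀ N Φ)) ∧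
      ∃ κ : ℝ, 0 < κ ∧ ∀ (φ : T3 → ℝ) (g : V3 → ℝ), Continuous φ → Continuous g →
        (∀ x, |φ x| ≤ 1) → (∀ v, |g v| ≤ κ) → Orthogonal g →
        ∀ δ : ℝ, 0 < δ → ∃ τ : ℝ, 0 < τ ∧ ∃ N₀ : ℕ, ∀ N : ℕ, N₀ ≤ N → ∀ Φ : Flow σ N,
          ∫⁻ z, ENNReal.ofReal (Real.exp ((window τ N)⁻¹ * ∫ s in (0 : ℝ)..(window τ N),
            ∑ i, φ (Φ.flow s z i).1 * g ((Real.sqrt θ)⁻¹ • ((Φ.flow s z i).2 - u₀))))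
              ∂(gibbs σ a θ u₀ N Φ) ≤ ENNReal.ofReal (Real.exp (δ * (N + 1))) := by
  intro a θ u₀ ha hθ
  obtain ⟨σ₄, hσ₄, H₄⟩ := h₄ a θ u₀ ha hθ
  obtain ⟨σ₅, hσ₅, H₅⟩ := h₅ a θ u₀ ha hθ
  refine ⟨min σ₄ σ₅, lt_min hσ₄ hσ₅, fun σ hσ hσlt => ?_⟩
  obtain ⟨hA, G₄⟩ := H₄ σ hσ (lt_of_lt_of_le hσlt (min_le_left _ _))
  obtain ⟨κ, hκ, G₅⟩ := H₅ σ hσ (lt_of_lt_of_le hσlt (min_le_right _ _))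
  refine ⟨hA, κ, hκ, fun φ g hφ hg hφ1 hgκ horth δ hδ => ?_⟩
  -- the L² input (10952) at tolerance δ/4, at its own window τ₁
  obtain ⟨τ₁, hτ₁, N₁, K₁⟩ := G₄ φ g hφ hg ⟨κ, hgκ⟩ horth (δ / 4) (by positivity)
  -- the cumulant input at tolerance δ, for all windows beyond τ₀
  obtain ⟨τ₀, hτ₀, K₅⟩ := G₅ φ g hφ hg hφ1 hgκ horth δ hδ
  -- the window of the crux: the first integer multiple of τ₁ beyond τ₀
  obtain ⟨m, hm0, hmτ⟩ : ∃ m : ℕ, 0 < m ∧ τ₀ ≤ (m : ℝ) * τ₁ := by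
    refine ⟨⌈τ₀ / τ₁⌉₊ + 1, Nat.succ_pos _, ?_⟩
    have h1 : τ₀ / τ₁ ≤ (⌈τ₀ / τ₁⌉₊ : ℝ) := Nat.le_ceil _
    have h2 : τ₀ / τ₁ ≤ ((⌈τ₀ / τ₁⌉₊ + 1 : ℕ) : ℝ) := by push_cast; linarith
    calc τ₀ = τ₀ / τ₁ * τ₁ := (div_mul_cancel₀ τ₀ hτ₁.ne').symm
      _ ≤ ((⌈τ₀ / τ₁⌉₊ + 1 : ℕ) : ℝ) * τ₁ := mul_le_mul_of_nonneg_right h2 hτ₁.le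
  obtain ⟨N₅, K₅'⟩ := K₅ ((m : ℝ) * τ₁) hmτ
  have hmpos : (0 : ℝ) < m := by exact_mod_cast hm0
  refine ⟨(m : ℝ) * τ₁, by positivity, max N₁ (max N₅ ⌈2 / δ⌉₊), fun N hN Φ => ?_⟩
  have hN₁ : N₁ ≤ N := le_trans (le_max_left _ _) hN
  have hN₅ : N₅ ≤ N := le_trans ((le_max_left _ _).trans (le_max_right _ _)) hN
  have hNδ : ⌈2 / δ⌉₊ ≤ N := le_trans ((le_max_right _ _).trans (le_max_right _ _)) hN
  have hx : 2 / δ ≤ (N : ℝ) + 1 := by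
    have := Nat.ceil_le.1 hNδ
    linarith
  -- the frame facts for μ = G_N
  set μ : Measure (Phase N) := gibbs σ a θ u₀ N Φ with hμ
  haveI : IsProbabilityMeasure μ := hA N Φ
  have hinv : ∀ t, MeasurePreserving (Φ.flow t) μ μ := fun t => gibbs_invariant σ a θ u₀ N Φ t
  have hgood : μ Φ.goodᶜ = 0 := gibbs_compl_good σ a θ u₀ N Φ
  set F : Phase N → ℝ := fluxObs θ u₀ φ g N with hF
  have hFm : Measurable F := measurable_fluxObs hφ hg N
  have hFb : ∃ C : ℝ, ∀ z, |F z| ≤ C := ⟨(N + 1) * κ, abs_fluxObs_le hφ1 hgκ N⟩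
  -- the two windows
  set hw : ℝ := window ((m : ℝ) * τ₁) N with hhw
  have hℓ : (0 : ℝ) < ((N + 1 : ℕ) : ℝ) ^ (-(1 / 3 : ℝ)) := Real.rpow_pos_of_pos (by positivity) _
  have hpos : 0 < hw := mul_pos (by positivity) hℓ
  have hw₁pos : 0 < window τ₁ N := mul_pos hτ₁ hℓ
  have hmw : (m : ℝ) * window τ₁ N = hw := by
    rw [hhw]
    exact (mul_assoc _ _ _).symm
  -- stub 1 (i) at β = 1/h and (ii); stub 2 fed by stub 5; stub 3 + 10952
  obtain ⟨I1, I2⟩ := h₁ _ _ Φ μ inferInstance hinv hgood F hFm hFb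
  have e1 := I1 hw⁻¹ hw hpos
  have e2 := I2 hw hpos
  have c2 : fejerInt Φ μ F hw⁻¹ hw ≤ fejerInt Φ μ F 0 hw + hw⁻¹ * (δ * hw * ((N : ℝ) + 1)) * hw ^ 2 / 2 :=
    h₂ _ _ Φ μ inferInstance hinv hgood F hFm hFb hw⁻¹ hw (δ * hw * ((N : ℝ) + 1))
      (inv_nonneg.2 hpos.le) hpos (K₅' N hN₅ Φ)
  have mono := h₃ _ _ Φ μ inferInstance hinv hgood F hFm hFb (window τ₁ N) m hw₁pos hm0
  rw [hmw] at mono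
  have l2 : ∫⁻ z, ENNReal.ofReal (((window τ₁ N)⁻¹ * pathInt Φ F (window τ₁ N) z) ^ 2) ∂μ ≤
      ENNReal.ofReal (δ / 4 * ((N : ℝ) + 1)) := K₁ N hN₁ Φ
  have hq : ∫⁻ z, ENNReal.ofReal ((hw⁻¹ * pathInt Φ F hw z) ^ 2) ∂μ ≤
      ENNReal.ofReal (δ / 4 * ((N : ℝ) + 1)) := mono.trans l2
  rw [e2] at hq
  have hq' : 2 * hw⁻¹ ^ 2 * fejerInt Φ μ F 0 hw + (∫ z, F z ∂μ) ^ 2 ≤ δ / 4 * ((N : ℝ) + 1) :=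
    (ENNReal.ofReal_le_ofReal_iff (by positivity)).1 hq
  have bound := exponent_bound hpos hδ hx hq' c2
  -- conclude
  refine le_trans (le_of_eq e1) ?_
  exact ENNReal.ofReal_le_ofReal (Real.exp_le_exp.2 bound)

/-- **The skeleton concludes the crux BY NAME** (payload route `AntiMazurCoboundaries`, shared item
stmt-AtomisticToContinuum-10967) from the five registered stubs. -/
theorem KineticFluxLdDecay_of :
    Summit.AtomisticToContinuum.HydrodynamicLimit.Theses.AntiMazurCoboundaries.KineticFluxLdDecay :=
  kineticFluxLdDecay_of_parts stub_selfTiltIdentities stub_tiltedCumulantComparison stub_squareWindowMonotone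
    stub_fastObservableMeanErgodic stub_tiltedThirdCumulantSublinear

/-- The same composition for the sibling route's decl (`FluxGibbsianityLdDrude`, r2; `rfl`-equal term). -/
theorem KineticFluxLdDecay_of_sibling :
    Summit.AtomisticToContinuum.HydrodynamicLimit.Theses.FluxGibbsianityLdDrude.KineticFluxLdDecay :=
  kineticFluxLdDecay_of_parts stub_selfTiltIdentities stub_tiltedCumulantComparison stub_squareWindowMonotone
    stub_fastObservableMeanErgodic stub_tiltedThirdCumulantSublinear

end Summit.AtomisticToContinuum.HydrodynamicLimit.Cruxes.KineticFluxLdDecay.SelfTiltedEdgeCovariance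

end
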